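import Summits.NavierStokesRegularity.NavierStokesRegularity.Theses.PerpetualPump
import Summits.NavierStokesRegularity.NavierStokesRegularity.Theorems.AveragedTypeIBlowup.Negative.NSReduction
import Literature.Analysis.FluidPDE.TaoAveragedCascadeHolds
import Literature.Analysis.FunctionSpaces.FourierSobolevNormEmbeddingProofs

/-!
# Crux `Thesis` (stmt-NavierStokesRegularity-1832), negative side: `H¹⁰ ⊂ L^∞`, the germ normal form of the Type-I hypothesis, and the failure of global continuation

Negative-side (cdisprove, D-0016) support lemmas extracted from `Cruxes/Thesis/Disproof.lean` (cycle 1, §4a–4a').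
The conclusion of `Thesis` (route target of `PerpetualPump`) is LOCAL continuation: a Type-I-bounded mild
solution on `[0,T)` extends to SOME `[0,T')`, `T' > T`. The natural strengthening "extends to a GLOBAL
mild solution `[0,∞) → H¹⁰_df`" is FALSE modulo local existence — Tao's Theorem 1.5
(`Tao2016.averagedNS_blowup_holds`, a theorem of the tree) supplies a symmetric cancelling averaged
equation and a Schwartz divergence-free datum with no global mild solution at all, while any local
solution from that datum, restricted to the first half of its lifetime, is `H¹⁰`-bounded, hence
`L^∞`-bounded, hence Type-I-bounded:

* `exists_eLpNorm_top_le_eFourierSobolevNorm` — **`H¹⁰(ℝ³) ⊂ L^∞(ℝ³)` on Tao's ambient space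
  `L²(ℝ³; ℂ³)`**: `‖u‖_{L^∞} ≤ K ‖u‖_{H¹⁰}` for a finite `K` (`= (∫ (1+|ξ|²)^{-10})^{1/2}`), via
  `‖u‖_∞ ≤ ‖û‖_{L¹}` (accepted `SobolevEmbeddingHalf.enorm_fourierInv_toLp_le`) and Cauchy–Schwarz
  (accepted `lintegral_enorm_le_sobolevWeight`). The embedding used informally throughout the route
  ("on `[0,T-δ]` an `H¹⁰`-continuous curve is `L^∞`-bounded"), now a lemma; no definitions added.
* `thesisShape_of_nonpos` — the degenerate sector `M ≤ 0` of the Type-I hypothesis is TRUE for every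
  datum (`u ≡ 0`, hence `a ⊥ H¹⁰_df`, hence `v ≡ 0` extends globally): no loophole in the constant.
* `thesis_iff_eventualRate` — NORMAL FORM: `Thesis` is equivalent to its version with the Type-I bound
  assumed only on a final interval `[t₀,T)`, `t₀ < T` (below any `T' < T` a mild solution is
  `H¹⁰`-bounded by compactness, `extension_H10_bounded`, hence `L^∞`-bounded). A disprover's witness
  need only be Type I as `t ↑ T`; a prover may assume the bound on all of `[0,T)`.
* `thesisGlobal_false_of_localExistence` — the global strengthening of `Thesis` is false (mod local
  existence `hloc`; Tao, remark after (1.15)). So the `∃ T' > T` shape of the crux is forced: for Tao's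
  datum the continued solution blows up later, at the Type-II rate.

Nothing here closes the item (`--supports`); no statement of the route changes.

## References

* T. Tao, J. Amer. Math. Soc. 29 (2016), 601–674 = arXiv:1402.0290v3, Thm. 1.5, §1.1 (1.15) and the
  remark following it. [`Tao2016AveragedNS`]
* J.-Y. Chemin, C.-J. Xu, Ann. Sci. ÉNS (4) 30 (1997), Introduction (9) (the `L¹`-Fourier sup bound).
  [`CheminXu1997`]
-/

noncomputable section

namespace Summit.NavierStokesRegularity.NavierStokesRegularity.Theorems.Thesis.Negative

open MeasureTheory Set Filter Topology FourierTransform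
open scoped ENNReal SchwartzMap
open Literature.Analysis.FluidPDE Literature.Analysis.FluidPDE.Tao2016
open Literature.Analysis.FunctionSpaces
open Summit.NavierStokesRegularity.NavierStokesRegularity.Theses.PerpetualPump
open Summit.NavierStokesRegularity.NavierStokesRegularity.Theorems.AveragedTypeIBlowup.Negative

/-- **`H¹⁰(ℝ³) ⊂ L^∞(ℝ³)`**: there is a finite constant `K` (namely `(∫ (1+|ξ|²)^{-10} dξ)^{1/2}`)
with `‖u‖_{L^∞} ≤ ‖û‖_{L¹} ≤ K ‖u‖_{H¹⁰}` for every `u ∈ L²(ℝ³; ℂ³)` of finite `H¹⁰` norm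
(Cauchy–Schwarz against `(1+|ξ|²)^{-10} ∈ L¹`, accepted `lintegral_enorm_le_sobolevWeight`; the `L²`
inverse Fourier transform of `û ∈ L¹ ∩ L²` is a.e. bounded by `∫ |û|`, accepted
`SobolevEmbeddingHalf.enorm_fourierInv_toLp_le`; `𝓕⁻¹𝓕u = u`). [cite: CheminXu1997, Introduction (9) p. 723] -/
theorem exists_eLpNorm_top_le_eFourierSobolevNorm :
    ∃ K : ℝ≥0∞, K < ∞ ∧ ∀ u : L2C, eFourierSobolevNorm 10 u < ∞ →
      eLpNorm (u : EuclideanSpace ℝ (Fin 3) → EuclideanSpace ℂ (Fin 3)) ⊤ volume ≤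
        K * eFourierSobolevNorm 10 u := by
  refine ⟨(∫⁻ ξ : EuclideanSpace ℝ (Fin 3), ENNReal.ofReal ((1 + ‖ξ‖ ^ 2) ^ (-10 : ℝ))) ^ (1 / 2 : ℝ),
    ENNReal.rpow_lt_top_of_nonneg (by norm_num) lintegral_inv_sobolevWeight_lt_top.ne, fun u hu => ?_⟩
  have hL1 : ∫⁻ ξ, ‖fourierFn u ξ‖ₑ ≤
      (∫⁻ ξ : EuclideanSpace ℝ (Fin 3), ENNReal.ofReal ((1 + ‖ξ‖ ^ 2) ^ (-10 : ℝ))) ^ (1 / 2 : ℝ) *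
        eFourierSobolevNorm 10 u := by
    rw [eFourierSobolevNorm_eq]
    exact lintegral_enorm_le_sobolevWeight (aestronglyMeasurable_fourierFn u)
  have hfin : ∫⁻ ξ, ‖fourierFn u ξ‖ₑ < ∞ :=
    hL1.trans_lt (ENNReal.mul_lt_top
      (ENNReal.rpow_lt_top_of_nonneg (by norm_num) lintegral_inv_sobolevWeight_lt_top.ne) hu)
  have h1 : Integrable (fourierFn u) volume := ⟨aestronglyMeasurable_fourierFn u, hfin⟩
  have h2 : MemLp (fourierFn u) 2 volume := Lp.memLp (𝓕 u : L2C)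
  have hLp : (𝓕⁻ (h2.toLp (fourierFn u)) : L2C) = u := by
    have : h2.toLp (fourierFn u) = (𝓕 u : L2C) := Lp.toLp_coeFn (𝓕 u : L2C) h2
    rw [this]
    exact fourierInv_fourier_eq u
  have hae := SobolevEmbeddingHalf.enorm_fourierInv_toLp_le h1 h2
  rw [hLp] at hae
  rw [eLpNorm_exponent_top]
  exact (eLpNormEssSup_le_of_ae_enorm_bound hae).trans hL1

/-- **The global-continuation strengthening of `Thesis` is FALSE (modulo local existence).** If every
symmetric averaging datum with cancellation has local `H¹⁰_df`-mild solutions from Schwartz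
divergence-free data (`hloc`), then it is NOT the case that every Type-I-bounded mild solution on every
`[0,T)` is the restriction of a GLOBAL mild solution: for Tao's blow-up datum
(`averagedNS_blowup_holds`) a local solution `u` on `[0,T₀)` is `H¹⁰`-bounded on `[0,T₀/2)`
(`extension_H10_bounded`), hence `L^∞`-bounded (`exists_eLpNorm_top_le_eFourierSobolevNorm`), hence obeys the
Type-I rate there with `M = sup ‖u‖_∞ · √(T₀/2)`, and a global continuation would be a global mild
solution. So continuation in `Thesis` is only ever local past `T`. [cite: Tao2016AveragedNS, Thm. 1.5] -/
theorem thesisGlobal_false_of_localExistence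
    (hloc : ∀ 𝒜 : AveragingDatum, 𝒜.IsSymmetric → 𝒜.HasCancellation →
      ∀ u₀ : 𝓢(EuclideanSpace ℝ (Fin 3), EuclideanSpace ℝ (Fin 3)), VectorCalculus.IsDivFree ⇑u₀ →
        ∃ T : ℝ, 0 < T ∧ ∃ u : ℝ → L2C, 𝒜.IsMildSolution (schwartzL2 u₀) (Ico 0 T) u) :
    ¬ ∀ 𝒜 : AveragingDatum, 𝒜.IsSymmetric → 𝒜.HasCancellation →
        ∀ u₀ : 𝓢(EuclideanSpace ℝ (Fin 3), EuclideanSpace ℝ (Fin 3)), VectorCalculus.IsDivFree ⇑u₀ →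
          ∀ T : ℝ, 0 < T → ∀ u : ℝ → L2C, 𝒜.IsMildSolution (schwartzL2 u₀) (Ico 0 T) u →
            (∃ M : ℝ, ∀ t ∈ Ico 0 T, eLpNorm (u t) ⊤ volume ≤ ENNReal.ofReal (M / Real.sqrt (T - t))) →
              ∃ v : ℝ → L2C, 𝒜.IsMildSolution (schwartzL2 u₀) (Ici 0) v ∧ ∀ t ∈ Ico 0 T, v t = u t := by
  intro h
  obtain ⟨𝒜, hs, hc, u₀, hdiv, hno⟩ := averagedNS_blowup_holds
  obtain ⟨T₀, hT₀, u, hu⟩ := hloc 𝒜 hs hc u₀ hdiv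
  have hT : 0 < T₀ / 2 := by linarith
  have hlt : T₀ / 2 < T₀ := by linarith
  have hu' : 𝒜.IsMildSolution (schwartzL2 u₀) (Ico 0 (T₀ / 2)) u :=
    hu.mono (Ico_subset_Ico_right hlt.le)
  obtain ⟨C, hC⟩ := extension_H10_bounded (T := T₀ / 2) hlt hu (fun t _ => rfl)
  obtain ⟨K, hK, hemb⟩ := exists_eLpNorm_top_le_eFourierSobolevNorm
  set B : ℝ≥0∞ := K * ENNReal.ofReal C with hB
  have hBfin : B ≠ ∞ := ENNReal.mul_ne_top hK.ne ENNReal.ofReal_ne_top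
  have hrate : ∃ M : ℝ, ∀ t ∈ Ico 0 (T₀ / 2),
      eLpNorm (u t) ⊤ volume ≤ ENNReal.ofReal (M / Real.sqrt (T₀ / 2 - t)) := by
    refine ⟨B.toReal * Real.sqrt (T₀ / 2), fun t ht => ?_⟩
    have hfin_t : eFourierSobolevNorm 10 (u t) < ∞ := (hC t ht).trans_lt ENNReal.ofReal_lt_top
    calc eLpNorm (u t) ⊤ volume ≤ K * eFourierSobolevNorm 10 (u t) := hemb _ hfin_t
      _ ≤ B := by rw [hB]; gcongr; exact hC t ht
      _ = ENNReal.ofReal B.toReal := (ENNReal.ofReal_toReal hBfin).symm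
      _ ≤ ENNReal.ofReal (B.toReal * Real.sqrt (T₀ / 2) / Real.sqrt (T₀ / 2 - t)) := by
          apply ENNReal.ofReal_le_ofReal
          have hpos : 0 < Real.sqrt (T₀ / 2 - t) := Real.sqrt_pos.2 (by linarith [ht.2])
          rw [le_div_iff₀ hpos]
          have hle : Real.sqrt (T₀ / 2 - t) ≤ Real.sqrt (T₀ / 2) :=
            Real.sqrt_le_sqrt (by linarith [ht.1])
          exact mul_le_mul_of_nonneg_left hle ENNReal.toReal_nonneg
  obtain ⟨v, hv, -⟩ := h 𝒜 hs hc u₀ hdiv (T₀ / 2) hT u hu' hrate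
  exact hno ⟨v, hv⟩

/-- **Normal form: the Type-I rate hypothesis only matters near `T`.** `Thesis` is equivalent to its
version in which the bound `‖u(t)‖_∞ ≤ M(T-t)^{-1/2}` is assumed only on a final interval `[t₀, T)`,
`t₀ < T`: below any `T' < T` a mild solution is `H¹⁰`-bounded (`extension_H10_bounded`, compactness),
hence `L^∞`-bounded (`exists_eLpNorm_top_le_eFourierSobolevNorm`), and `(T-t)^{-1/2} ≥ T^{-1/2}` there. For
the disprover: a witness need only be Type I in the limit `t ↑ T`; for the prover: the bound may be
assumed on all of `[0,T)` at no cost. [folklore] -/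
theorem thesis_iff_eventualRate :
    Thesis ↔ ∀ 𝒜 : AveragingDatum, 𝒜.IsSymmetric → 𝒜.HasCancellation →
      ∀ u₀ : 𝓢(EuclideanSpace ℝ (Fin 3), EuclideanSpace ℝ (Fin 3)), VectorCalculus.IsDivFree ⇑u₀ →
        ∀ T : ℝ, 0 < T → ∀ u : ℝ → L2C, 𝒜.IsMildSolution (schwartzL2 u₀) (Ico 0 T) u →
          (∃ t₀ M : ℝ, t₀ < T ∧ ∀ t ∈ Ico 0 T, t₀ ≤ t →
              eLpNorm (u t) ⊤ volume ≤ ENNReal.ofReal (M / Real.sqrt (T - t))) →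
            ∃ T' : ℝ, T < T' ∧ ∃ v : ℝ → L2C,
              𝒜.IsMildSolution (schwartzL2 u₀) (Ico 0 T') v ∧ ∀ t ∈ Ico 0 T, v t = u t := by
  constructor
  · intro h 𝒜 hs hc u₀ hdiv T hT u hu hev
    refine h 𝒜 hs hc u₀ hdiv T hT u hu ?_
    obtain ⟨t₀, M, ht₀T, hM⟩ := hev
    set s := max t₀ 0 with hs_def
    have hsT : s < T := max_lt ht₀T hT
    set T' := (s + T) / 2 with hT'_def
    have hT'T : T' < T := by rw [hT'_def]; linarith
    have hsT' : s < T' := by rw [hT'_def]; linarith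
    obtain ⟨C, hC⟩ := extension_H10_bounded (T := T') hT'T hu (fun t _ => rfl)
    obtain ⟨K, hK, hemb⟩ := exists_eLpNorm_top_le_eFourierSobolevNorm
    set B : ℝ≥0∞ := K * ENNReal.ofReal C with hB
    have hBfin : B ≠ ∞ := ENNReal.mul_ne_top hK.ne ENNReal.ofReal_ne_top
    refine ⟨max (B.toReal * Real.sqrt T) M, fun t ht => ?_⟩
    have hpos : 0 < Real.sqrt (T - t) := Real.sqrt_pos.2 (by linarith [ht.2])
    by_cases hts : t < s
    · have htT' : t ∈ Ico 0 T' := ⟨ht.1, hts.trans hsT'⟩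
      have hfin_t : eFourierSobolevNorm 10 (u t) < ∞ := (hC t htT').trans_lt ENNReal.ofReal_lt_top
      calc eLpNorm (u t) ⊤ volume ≤ K * eFourierSobolevNorm 10 (u t) := hemb _ hfin_t
        _ ≤ B := by rw [hB]; gcongr; exact hC t htT'
        _ = ENNReal.ofReal B.toReal := (ENNReal.ofReal_toReal hBfin).symm
        _ ≤ ENNReal.ofReal (max (B.toReal * Real.sqrt T) M / Real.sqrt (T - t)) := by
            apply ENNReal.ofReal_le_ofReal
            rw [le_div_iff₀ hpos]
            have hle : Real.sqrt (T - t) ≤ Real.sqrt T := Real.sqrt_le_sqrt (by linarith [ht.1])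
            calc B.toReal * Real.sqrt (T - t) ≤ B.toReal * Real.sqrt T :=
                  mul_le_mul_of_nonneg_left hle ENNReal.toReal_nonneg
              _ ≤ max (B.toReal * Real.sqrt T) M := le_max_left _ _
    · have ht₀t : t₀ ≤ t := (le_max_left t₀ 0).trans (not_lt.1 hts)
      refine (hM t ht ht₀t).trans (ENNReal.ofReal_le_ofReal ?_)
      exact div_le_div_of_nonneg_right (le_max_right _ _) hpos.le
  · intro h 𝒜 hs hc u₀ hdiv T hT u hu hrate
    refine h 𝒜 hs hc u₀ hdiv T hT u hu ?_
    obtain ⟨M, hM⟩ := hrate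
    exact ⟨0, M, hT, fun t ht _ => hM t ht⟩

/-- **The degenerate sector `M ≤ 0` of `Thesis` is TRUE (for every averaging datum and every datum
class).** A Type-I bound with constant `M ≤ 0` forces `u(t) = 0` in `L²` for all `t ∈ [0,T)`
(`‖u(t)‖_{L^∞} ≤ 0`); the mild identity at `t = 0` then gives `⟨a, w⟩ = 0` for every `w ∈ H¹⁰_df`,
whence `⟨e^{tΔ}a, w⟩ = ⟨a, e^{tΔ}w⟩ = 0` (`pairing_heat_left`, `MemH10df.heat`) for ALL `t ≥ 0`, and
`v ≡ 0` is a global mild solution from `a` extending `u`. So the constant carries no degenerate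
loophole: a disprover's witness has `M > 0` (and then WLOG `M = 1`, crux #3's cone lemma). [folklore] -/
theorem thesisShape_of_nonpos (𝒜 : AveragingDatum) (a : L2C) {T M : ℝ} (hT : 0 < T) (hM : M ≤ 0)
    {u : ℝ → L2C} (hu : 𝒜.IsMildSolution a (Ico 0 T) u)
    (hrate : ∀ t ∈ Ico 0 T, eLpNorm (u t) ⊤ volume ≤ ENNReal.ofReal (M / Real.sqrt (T - t))) :
    ∃ T' : ℝ, T < T' ∧ ∃ v : ℝ → L2C, 𝒜.IsMildSolution a (Ico 0 T') v ∧ ∀ t ∈ Ico 0 T, v t = u t := by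
  have hzero : ∀ t ∈ Ico 0 T, u t = 0 := by
    intro t ht
    have h0 : ENNReal.ofReal (M / Real.sqrt (T - t)) = 0 :=
      ENNReal.ofReal_eq_zero.2 (div_nonpos_of_nonpos_of_nonneg hM (Real.sqrt_nonneg _))
    have h1 : eLpNorm (u t) ⊤ volume = 0 := nonpos_iff_eq_zero.1 (h0 ▸ hrate t ht)
    rw [eLpNorm_eq_zero_iff (Lp.aestronglyMeasurable (u t)) ENNReal.top_ne_zero] at h1
    exact Lp.eq_zero_iff_ae_eq_zero.2 h1
  have hu' : IsMildSolutionFor 𝒜.form a (Ico 0 T) u := hu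
  have horth : ∀ w, MemH10df w → pairing a w = 0 := by
    intro w hw
    have h := hu'.2.2 0 ⟨le_rfl, hT⟩ w hw
    rw [hzero 0 ⟨le_rfl, hT⟩, intervalIntegral.integral_same, add_zero, heat_zero,
      pairing_zero_left] at h
    exact h.symm
  refine ⟨T + 1, by linarith, fun _ => 0, ⟨fun _ _ => memH10df_zero, continuousInH10On_zero _,
    fun t _ w hw => ?_⟩, fun t ht => (hzero t ht).symm⟩
  simp only [AveragingDatum.form_zero_left, intervalIntegral.integral_zero, add_zero, pairing_zero_left]
  rw [pairing_heat_left]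
  exact (horth _ (hw.heat t)).symm

end Summit.NavierStokesRegularity.NavierStokesRegularity.Theorems.Thesis.Negative

end
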